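import Mathlib
import Summits.ResolutionOfSingularities.ResolutionOfSingularities.Theorems.WeightedInvariantLocalWeightedDropNCResBadDirB

/-!
# `WeightedInvariant.LocalWeightedDrop` ENGINE, W′|₄ line — D₃ᴮ object (13): THE REGIME SPLIT AND REGIME (B) IN B-FORM HOLD FROM `o ≥ 1` (hand D, 2/3)

Sub-problem `ResolutionOfSingularities`, ENGINE crux `stmt-ResolutionOfSingularities-8899` (`LocalWeightedDrop`), registered stub W′|₄
`stub_wildWideApexFourStartsWon`; res-L1-w43-plan-1 RULING 2026-08-27T21:45:42Z (D₃ᴮ lane), hand D (the `o ≤ 1` endgame).  [OURS · L1 W4.3 · chain w43 ·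
res-L1-w43-lead-1 g6; def-free; the proofs of res-L1-w43-lead-1 g5's `Decoration.exists_isDirForm_of_not_hCol` / `regime_split` (…NCResRegimeDefs) and of
…NCResBadDirB VERBATIM with `2 ≤ δ.o` weakened to `1 ≤ δ.o` (used only through `0 < c` / `1 ≤ o`).  Nothing here is a statement of any manuscript; AI-produced,
gate-checked, weaker than expert review.]

* `Decoration.exists_isDirForm_of_not_hCol₁`, `Decoration.regime_split₁` — outside the apex column a directrix form exists and the state has a history, or is in
  good / bad position, or has a letter directrix — from `o ≥ 1`;
* `NCResBad.dbWinsTo_exit_of_badDir_level₁ / _inOffIdeal₁ / _badDir₁`, **`regimeBadB₁`** — regime (B) in B-form from `o ≥ 1`.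
-/

set_option linter.dupNamespace false -- mandated namespace of this single-conjunct summit

noncomputable section

namespace Summit.ResolutionOfSingularities.ResolutionOfSingularities.Theorems

namespace TameFourTupleDrop

open MvPowerSeries Literature.AlgebraicGeometry.Resolution GraphCurve TOT2E1

variable {k : Type} [Field k]

namespace Decoration

/-- **`¬ HCol` ⇒ a directrix form exists** (three letters, admissible state with `1 ≤ o` — the proof of `exists_isDirForm_of_not_hCol` verbatim): two independent invariance vectors make the degree-`c`
form `λ · (ℓ · v)^c` (`WildPurePower.cone_eq_of_wide`), and `λ ≠ 0` because the form of a germ of order exactly `c > 0` is not invariant under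
every vector (`TOT2Near.order_ne_of_forall_inv`). -/
theorem exists_isDirForm_of_not_hCol₁ [Infinite k] {b : MvPowerSeries (Fin (2 + 1)) k} {δ : Decoration k 2} (hadm : Admissible b δ)
    (ho : 1 ≤ δ.o) (h : ¬ δ.HCol) : ∃ ℓ : Fin (2 + 1) → k, δ.IsDirForm ℓ := by
  unfold HCol at h
  push Not at h
  obtain ⟨v₁, v₂, h₁, h₂, hind⟩ := h
  have hind' : ∀ α β : k, α • v₁ + β • v₂ = 0 → α = 0 ∧ β = 0 := by
    intro α β hαβ
    by_contra hne
    exact hind α β (by tauto) hαβ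
  have h₁' : ∀ v : Fin 3 → k, CobordantChart.initEval (fun _ : Fin 3 => 1) (v + v₁) δ.c (δ.f * ∏ l ∈ δ.O, X l) =
      CobordantChart.initEval (fun _ : Fin 3 => 1) v δ.c (δ.f * ∏ l ∈ δ.O, X l) := h₁
  have h₂' : ∀ v : Fin 3 → k, CobordantChart.initEval (fun _ : Fin 3 => 1) (v + v₂) δ.c (δ.f * ∏ l ∈ δ.O, X l) =
      CobordantChart.initEval (fun _ : Fin 3 => 1) v δ.c (δ.f * ∏ l ∈ δ.O, X l) := h₂
  obtain ⟨la, ℓ, hℓ, hcone⟩ := WildPurePower.cone_eq_of_wide (δ.f * ∏ l ∈ δ.O, X l) δ.c v₁ v₂ hind' h₁' h₂'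
  refine ⟨ℓ, hℓ, la, ?_, hcone⟩
  intro hla
  have hc : 0 < δ.c := by unfold Decoration.c; omega
  refine TOT2Near.order_ne_of_forall_inv hc (f := δ.f * ∏ l ∈ δ.O, X l) (fun u v => ?_)
    (by rw [Decoration.order_totalO hadm])
  rw [hcone, hcone, hla, zero_mul, zero_mul]

/-- **THE REGIME SPLIT FROM `o ≥ 1`** (three letters): an admissible state with `1 ≤ o` outside the apex column has a non-empty history, or is in good position, or
in bad position, or its directrix is a boundary letter. -/
theorem regime_split₁ [Infinite k] {b : MvPowerSeries (Fin (2 + 1)) k} {δ : Decoration k 2} (hadm : Admissible b δ) (ho : 1 ≤ δ.o)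
    (h : ¬ δ.HCol) : δ.O.Nonempty ∨ δ.GoodDir ∨ δ.BadDir ∨ ∃ l, δ.LetterDir l := by
  classical
  obtain ⟨ℓ, hℓ⟩ := exists_isDirForm_of_not_hCol₁ hadm ho h
  rcases Finset.eq_empty_or_nonempty δ.O with hO | hO
  · right
    by_cases hgood : ∃ j : Fin (2 + 1), j ∉ δ.E ∧ ℓ j ≠ 0
    · exact Or.inl ⟨hO, ℓ, hℓ, hgood⟩
    push Not at hgood
    have hsupp : ∀ j, ℓ j ≠ 0 → j ∈ δ.E := fun j hj => by
      by_contra hjE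
      exact hj (hgood j hjE)
    right
    by_cases hbad : ∃ j j' : Fin (2 + 1), j ≠ j' ∧ ℓ j ≠ 0 ∧ ℓ j' ≠ 0
    · exact Or.inl ⟨hO, ℓ, hℓ, hsupp, hbad⟩
    push Not at hbad
    right
    obtain ⟨l, hl⟩ : ∃ l, ℓ l ≠ 0 := by
      by_contra hall
      push Not at hall
      exact hℓ.1 (funext hall)
    refine ⟨l, hO, hsupp l hl, isDirForm_single_of_support hℓ fun j hj => ?_⟩
    by_contra hj0
    exact hl (hbad j l hj hj0)
  · exact Or.inl hO

end Decoration

namespace NCResBad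


/-- **THE POINT LOOP OF REGIME (B), B-PERMISSIBLE FORM** (re-thread of `dWinsTo_exit_of_badDir_level`: the moves there are the identity point
blow-ups, B-permissible for every decoration, and the successors are the transforms).  Three letters, `k` infinite.  From an admissibly decorated state with `o ≥ 2`, empty history, a
directrix form `ℓ` supported on boundary letters, and either FULL support or support of size two with a failing integer level of `f` along the
free letter, the director wins to «admissibly decorated, and: head drop, or same head with apex column or good position» — by identity point
blow-ups. -/
theorem dbWinsTo_exit_of_badDir_level₁ [Infinite k] {b : MvPowerSeries (Fin (2 + 1)) k} {δ : Decoration k 2} (hadm : Admissible b δ)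
    (ho : 1 ≤ δ.o) (hO : δ.O = ∅) {ℓ : Fin (2 + 1) → k} (hℓ : δ.IsDirForm ℓ) (hsupp : ∀ j, ℓ j ≠ 0 → j ∈ δ.E)
    (hdata : (∀ j, ℓ j ≠ 0) ∨ ∃ j, ℓ j = 0 ∧ (∀ l, l ≠ j → ℓ l ≠ 0) ∧
      ∃ r : ℕ, ¬ (∀ E : Fin (2 + 1) →₀ ℕ, offDeg j E < δ.o → E j < r * (δ.o - offDeg j E) → coeff E δ.f = 0)) :
    DBWinsTo (fun τ : MvPowerSeries (Fin (2 + 1)) k × Decoration k 2 =>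
      Admissible τ.1 τ.2 ∧ (τ.2.head < δ.head ∨ (τ.2.head = δ.head ∧ (τ.2.HCol ∨ τ.2.GoodDir)))) (b, δ) := by
  classical
  -- the two kinds of states of the loop
  set Full : (MvPowerSeries (Fin (2 + 1)) k × Decoration k 2) → Prop := fun τ =>
    ∃ ℓ : Fin (2 + 1) → k, τ.2.IsDirForm ℓ ∧ (∀ j, ℓ j ≠ 0 → j ∈ τ.2.E) ∧ ∀ j, ℓ j ≠ 0 with hFull
  set Two : (MvPowerSeries (Fin (2 + 1)) k × Decoration k 2) → ℕ → Prop := fun τ r =>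
    ∃ (ℓ : Fin (2 + 1) → k) (j : Fin (2 + 1)), τ.2.IsDirForm ℓ ∧ (∀ j, ℓ j ≠ 0 → j ∈ τ.2.E) ∧ ℓ j = 0 ∧ (∀ l, l ≠ j → ℓ l ≠ 0) ∧
      ¬ (∀ E : Fin (2 + 1) →₀ ℕ, offDeg j E < τ.2.o → E j < r * (τ.2.o - offDeg j E) → coeff E τ.2.f = 0) with hTwo
  set Cl : Set (MvPowerSeries (Fin (2 + 1)) k × Decoration k 2) :=
    {τ | Admissible τ.1 τ.2 ∧ τ.2.head = δ.head ∧ τ.2.O = ∅ ∧ (Full τ ∨ ∃ r, Two τ r)} with hCl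
  set μ : (MvPowerSeries (Fin (2 + 1)) k × Decoration k 2) → Ordinal.{0} := fun τ =>
    ((sInf {N : ℕ | (Full τ ∧ N = 0) ∨ ∃ r, Two τ r ∧ N = r + 1} : ℕ) : Ordinal.{0}) with hμ
  -- measure bookkeeping
  have hμ_le_Full : ∀ τ, Full τ → μ τ = 0 := by
    intro τ h
    have hmem : (0 : ℕ) ∈ {N : ℕ | (Full τ ∧ N = 0) ∨ ∃ r, Two τ r ∧ N = r + 1} := Or.inl ⟨h, rfl⟩
    have h0 : sInf {N : ℕ | (Full τ ∧ N = 0) ∨ ∃ r, Two τ r ∧ N = r + 1} = 0 := Nat.eq_zero_of_le_zero (Nat.sInf_le hmem)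
    simp only [hμ, h0, Nat.cast_zero]
  have hμ_le_Two : ∀ τ r, Two τ r → μ τ ≤ ((r + 1 : ℕ) : Ordinal.{0}) := by
    intro τ r h
    have hmem : r + 1 ∈ {N : ℕ | (Full τ ∧ N = 0) ∨ ∃ r, Two τ r ∧ N = r + 1} := Or.inr ⟨r, h, rfl⟩
    exact Nat.cast_le.mpr (Nat.sInf_le hmem)
  have hμ_eq : ∀ τ, (Full τ ∨ ∃ r, Two τ r) → (Full τ ∧ μ τ = 0) ∨ ∃ r, Two τ r ∧ μ τ = ((r + 1 : ℕ) : Ordinal.{0}) := by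
    rintro τ hcase
    have hne : ({N : ℕ | (Full τ ∧ N = 0) ∨ ∃ r, Two τ r ∧ N = r + 1} : Set ℕ).Nonempty := by
      rcases hcase with h | ⟨r, h⟩
      · exact ⟨0, Or.inl ⟨h, rfl⟩⟩
      · exact ⟨r + 1, Or.inr ⟨r, h, rfl⟩⟩
    rcases Nat.sInf_mem hne with ⟨hF, h0⟩ | ⟨r, hr, hN⟩
    · exact Or.inl ⟨hF, by simp only [hμ, h0, Nat.cast_zero]⟩
    · exact Or.inr ⟨r, hr, by simp only [hμ, hN]⟩
  -- the start
  have hstart : (b, δ) ∈ Cl := by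
    refine ⟨hadm, rfl, hO, ?_⟩
    rcases hdata with hfull | ⟨j, hj0, hne, r, hr⟩
    · exact Or.inl ⟨ℓ, hℓ, hsupp, hfull⟩
    · exact Or.inr ⟨r, ℓ, j, hℓ, hsupp, hj0, hne, hr⟩
  refine DBWinsTo.of_measure Cl μ ?_ hstart
  -- THE STEP: from `τ ∈ Cl`, play the identity point blow-up
  rintro ⟨bτ, δτ⟩ ⟨hadmτ, hheadτ, hOτ, hcase⟩ -
  dsimp only at hadmτ hheadτ hOτ hcase
  have hf : δτ.f ≠ 0 := hadmτ.2.1.ne_zero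
  have hoτ : δτ.o = δ.o := by
    have h := hheadτ
    rw [Decoration.head, Decoration.head, toLex_inj, Prod.mk.injEq] at h
    exact h.1
  have ho1 : 1 ≤ δτ.o := by omega
  have hperm := isBPermissible_point_X (k := k) δτ
  have hconv : ∀ (cc : Fin (2 + 1) → k) (l : Fin (2 + 1)), (fun _ : Fin (2 + 1) => (1 : ℕ)) l = 0 → cc l = 0 :=
    fun cc l hl => absurd hl one_ne_zero
  refine ⟨fun j => X j, fun _ => 1, hperm, ?_⟩
  intro c _ hc0 A G hfac hG
  obtain ⟨i, hci⟩ : ∃ i, c i ≠ 0 := Function.ne_iff.mp hc0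
  set δ' := δτ.transform (fun j => (X j : MvPowerSeries (Fin (2 + 1)) k)) (fun _ => 1) c i with hδ'
  have hadm' : Admissible (X 0 * TupleGame.slice i G) δ' := admissible_transform hadmτ hperm (hconv c) hfac hG hci
  have hhead' : δ'.head ≤ δτ.head := Decoration.head_transform_le hperm (hconv c) hf hci
  refine ⟨i, hci, ?_⟩
  change (Admissible (X 0 * TupleGame.slice i G) δ' ∧ (δ'.head < δ.head ∨ (δ'.head = δ.head ∧ (δ'.HCol ∨ δ'.GoodDir)))) ∨
    ((X 0 * TupleGame.slice i G, δ') ∈ Cl ∧ μ (X 0 * TupleGame.slice i G, δ') < μ (bτ, δτ))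
  by_cases hlt : δ'.head < δτ.head
  · exact Or.inl ⟨hadm', Or.inl (by rw [← hheadτ]; exact hlt)⟩
  have heq : δ'.head = δτ.head := le_antisymm hhead' (not_lt.mp hlt)
  have hO' : δ'.O = ∅ := Decoration.transform_O_eq_empty_of_head_eq hOτ heq
  have ho' : δ'.o = δτ.o := Decoration.o_transform_of_head_eq heq
  -- apex column: exit
  by_cases hH : δ'.HCol
  · exact Or.inl ⟨hadm', Or.inr ⟨by rw [heq, hheadτ], Or.inl hH⟩⟩
  -- otherwise a directrix form of the transform
  obtain ⟨ℓ', hℓ'⟩ := Decoration.exists_isDirForm_of_not_hCol₁ hadm' (by rw [ho']; omega) hH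
  -- the state's data, with the measure achieved
  rcases hμ_eq (bτ, δτ) hcase with ⟨⟨ℓτ, hℓτ, hsuppτ, hfullτ⟩, hμτ⟩ | ⟨r, ⟨ℓτ, j, hℓτ, hsuppτ, hj0, hneτ, hr⟩, hμτ⟩
  · -- FULL SUPPORT: every same-head answer outside the apex column is in good position
    have hdot : dotProduct ℓτ c = 0 := dotProduct_answer_eq_zero hadmτ ho1 hci hadm' heq hℓτ
    -- some `l ≠ i` has `c_l ≠ 0` (else `ℓ_i c_i = 0`)
    obtain ⟨l, hli, hcl⟩ : ∃ l, l ≠ i ∧ c l ≠ 0 := by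
      by_contra hnone
      push Not at hnone
      rw [dotProduct_eq_single_term (fun l hl _ => hnone l hl)] at hdot
      exact (mul_ne_zero (hfullτ i) hci) hdot
    obtain ⟨p, rfl⟩ := Fin.exists_succAbove_eq hli
    have hℓ'p : ℓ' p.succ ≠ 0 := fun h =>
      hfullτ _ ((dirForm_transform_succ_eq_zero_iff hadmτ ho1 hci heq hℓτ hℓ' p).mp h)
    have hnot : p.succ ∉ δ'.E := fun h => hcl ((Decoration.succ_mem_transform_E_iff δτ _ hci p).mp h).2
    exact Or.inl ⟨hadm', Or.inr ⟨by rw [heq, hheadτ], Or.inr ⟨hO', ℓ', hℓ', p.succ, hnot, hℓ'p⟩⟩⟩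
  · -- SUPPORT OF SIZE TWO with free letter `j` and failing level `r`
    have hdot : dotProduct ℓτ c = 0 := dotProduct_answer_eq_zero hadmτ ho1 hci hadm' heq hℓτ
    by_cases hex : ∃ l, l ≠ i ∧ ℓτ l ≠ 0 ∧ c l ≠ 0
    · -- (a) a support letter other than the slot leaves: good position
      obtain ⟨l, hli, hℓl, hcl⟩ := hex
      obtain ⟨p, rfl⟩ := Fin.exists_succAbove_eq hli
      have hℓ'p : ℓ' p.succ ≠ 0 := fun h =>
        hℓl ((dirForm_transform_succ_eq_zero_iff hadmτ ho1 hci heq hℓτ hℓ' p).mp h)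
      have hnot : p.succ ∉ δ'.E := fun h => hcl ((Decoration.succ_mem_transform_E_iff δτ _ hci p).mp h).2
      exact Or.inl ⟨hadm', Or.inr ⟨by rw [heq, hheadτ], Or.inr ⟨hO', ℓ', hℓ', p.succ, hnot, hℓ'p⟩⟩⟩
    · -- (b) the axis point: `ℓ_i = 0`, `i = j`, `c = c_j e_j`
      push Not at hex
      have hℓi : ℓτ i = 0 := by
        by_contra hne
        rw [dotProduct_eq_single_term (fun l hl hℓl => hex l hl hℓl)] at hdot
        exact (mul_ne_zero hne hci) hdot
      have hij : i = j := by
        by_contra hne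
        exact hneτ i hne hℓi
      subst hij
      have haxis : ∀ l, l ≠ i → c l = 0 := fun l hl => hex l hl (hneτ l hl)
      -- the transform: support letters `p⁺` (both non-zero, both boundary letters), maybe `s`
      have hℓ'succ : ∀ p : Fin 2, ℓ' p.succ ≠ 0 := fun p h =>
        hneτ _ (Fin.succAbove_ne i p) ((dirForm_transform_succ_eq_zero_iff hadmτ ho1 hci heq hℓτ hℓ' p).mp h)
      have hsupp' : ∀ q, ℓ' q ≠ 0 → q ∈ δ'.E := by
        intro q hq
        rcases Fin.eq_zero_or_eq_succ q with rfl | ⟨p, rfl⟩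
        · exact Decoration.zero_mem_transform_E δτ _ _ c i
        · have hl : ℓτ (i.succAbove p) ≠ 0 := hneτ _ (Fin.succAbove_ne i p)
          exact (Decoration.succ_mem_transform_E_iff δτ _ hci p).mpr ⟨hsuppτ _ hl, haxis _ (Fin.succAbove_ne i p)⟩
      right
      by_cases hℓ'0 : ℓ' 0 = 0
      · -- `|S′| = 2`, free letter `s = 0`: the level drops by one
        have hr1 : 1 ≤ r := one_le_of_not_level hr
        -- the new equation is the sliced strict transform
        set Gf := satPart (δτ.fChart (fun j => (X j : MvPowerSeries (Fin (2 + 1)) k)) (fun _ => 1) c) with hGf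
        have hfacf : subst (CobordantChart.chart (fun _ : Fin (2 + 1) => 1) c) δτ.f = X 0 ^ δτ.o * Gf := chart_f_eq hadmτ c
        have hf' : δ'.f = TupleGame.slice i Gf := by
          have h := totalO_transform_eq_slice hadmτ hci heq
          rw [hO', hOτ, Finset.prod_empty, Finset.prod_empty, mul_one, mul_one] at h
          exact h
        have hlev' : ¬ (∀ E : Fin (2 + 1) →₀ ℕ, offDeg 0 E < δ'.o → E 0 < (r - 1) * (δ'.o - offDeg 0 E) → coeff E δ'.f = 0) := by
          rw [ho', hf']
          refine not_level_slice_of_not_level haxis hci (fun E hE => o_le_degree_of_coeff_ne_zero δτ hf hE) hfacf ?_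
          rw [Nat.sub_add_cancel hr1]
          exact hr
        have hTwo' : Two (X 0 * TupleGame.slice i G, δ') (r - 1) :=
          ⟨ℓ', 0, hℓ', hsupp', hℓ'0, fun l hl => by
            obtain ⟨p, rfl⟩ := Fin.exists_succ_eq.mpr hl
            exact hℓ'succ p, hlev'⟩
        refine ⟨⟨hadm', by rw [heq, hheadτ], hO', Or.inr ⟨r - 1, hTwo'⟩⟩, ?_⟩
        calc μ (X 0 * TupleGame.slice i G, δ') ≤ ((r - 1 + 1 : ℕ) : Ordinal.{0}) := hμ_le_Two _ _ hTwo'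
          _ < ((r + 1 : ℕ) : Ordinal.{0}) := Nat.cast_lt.mpr (by omega)
          _ = μ (bτ, δτ) := hμτ.symm
      · -- `|S′| = 3`: measure `0`
        have hFull' : Full (X 0 * TupleGame.slice i G, δ') :=
          ⟨ℓ', hℓ', hsupp', fun q => by
            rcases Fin.eq_zero_or_eq_succ q with rfl | ⟨p, rfl⟩
            · exact hℓ'0
            · exact hℓ'succ p⟩
        refine ⟨⟨hadm', by rw [heq, hheadτ], hO', Or.inl hFull'⟩, ?_⟩
        calc μ (X 0 * TupleGame.slice i G, δ') = 0 := hμ_le_Full _ hFull'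
          _ < ((r + 1 : ℕ) : Ordinal.{0}) := Nat.cast_lt.mpr (Nat.succ_pos r) |>.trans_eq' (Nat.cast_zero).symm
          _ = μ (bτ, δτ) := hμτ.symm

/-! ## The curve move, B-form -/

/-- **REGIME (B), THE PERMISSIBLE-AXIS CASE: ONE CURVE MOVE EXITS — B-PERMISSIBLE FORM** (re-thread of `dWinsTo_exit_of_badDir_inOffIdeal`:
the curve move there is B-permissible by `isBPermissible_of_totalO_weightedOrder` and the successors are the transforms).  Three letters, `k` infinite.  From an admissibly decorated state with
`o ≥ 2`, empty history, a directrix form `ℓ` vanishing exactly at the letter `j`, and `f ∈ (x_l : l ≠ j)^o`, the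
director wins to «admissibly decorated, and: head drop, or same head with apex column or good position» by the single curve move
`(X, 𝟙_{l ≠ j})`. -/
theorem dbWinsTo_exit_of_badDir_inOffIdeal₁ [Infinite k] {b : MvPowerSeries (Fin (2 + 1)) k} {δ : Decoration k 2} (hadm : Admissible b δ)
    (ho : 1 ≤ δ.o) (hO : δ.O = ∅) {ℓ : Fin (2 + 1) → k} (hℓ : δ.IsDirForm ℓ) {j : Fin (2 + 1)}
    (hj0 : ℓ j = 0) (hne : ∀ l, l ≠ j → ℓ l ≠ 0) (hin : InOffIdeal j δ.o δ.f) :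
    DBWinsTo (fun τ : MvPowerSeries (Fin (2 + 1)) k × Decoration k 2 =>
      Admissible τ.1 τ.2 ∧ (τ.2.head < δ.head ∨ (τ.2.head = δ.head ∧ (τ.2.HCol ∨ τ.2.GoodDir)))) (b, δ) := by
  classical
  have hf : δ.f ≠ 0 := hadm.2.1.ne_zero
  have hc_eq : δ.c = δ.o := by rw [Decoration.c, hO, Finset.card_empty, add_zero]
  have hg : δ.f * ∏ l ∈ δ.O, X l = δ.f := by rw [hO, Finset.prod_empty, mul_one]
  -- the move `(X, 𝟙_{l ≠ j})`
  set w : Fin (2 + 1) → ℕ := fun l => if l = j then 0 else 1 with hw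
  have hw1 : ∀ l, w l ≤ 1 := fun l => by simp only [hw]; split_ifs <;> simp
  have hwj : w j = 0 := by simp only [hw, if_true]
  have hwl : ∀ l, l ≠ j → w l = 1 := fun l hl => by simp only [hw, if_neg hl]
  have hmv : IsCountMove (fun l => (X l : MvPowerSeries (Fin (2 + 1)) k)) w :=
    ⟨fun l => constantCoeff_X l, TupleMonomialPhase.isUnit_det_X, hw1,
      ⟨j.succAbove 0, by rw [hwl _ (Fin.succAbove_ne j 0)]; exact Nat.one_pos⟩⟩
  have hP3 : ∀ l ∈ δ.E, ∃ (l' : Fin (2 + 1)) (u : MvPowerSeries (Fin (2 + 1)) k), constantCoeff u ≠ 0 ∧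
      (fun l => (X l : MvPowerSeries (Fin (2 + 1)) k)) l = u * X l' :=
    fun l _ => ⟨l, 1, by rw [map_one]; exact one_ne_zero, by rw [one_mul]⟩
  have hpermw : ((δ.o : ℕ) : ℕ∞) ≤ δ.f.weightedOrder w := le_weightedOrder_of_inOffIdeal hin
  have hP1g : ((δ.c : ℕ) : ℕ∞) ≤ (subst (fun l => (X l : MvPowerSeries (Fin (2 + 1)) k)) (δ.f * ∏ l ∈ δ.O, X l)).weightedOrder w := by
    rw [hg, subst_X_fun, hc_eq]; exact hpermw
  have hperm : IsBPermissible δ (fun l => (X l : MvPowerSeries (Fin (2 + 1)) k)) w :=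
    isBPermissible_of_totalO_weightedOrder hadm hmv hP3 hP1g
  -- one move: every answer exits
  refine DBWinsTo.of_measure {σ | σ = (b, δ)} (fun _ => 0) ?_ rfl
  rintro τ hτ -
  rw [Set.mem_setOf_eq] at hτ
  subst hτ
  refine ⟨fun l => X l, w, hperm, ?_⟩
  intro c hc hc0 A G hfac hG
  have hcj : c j = 0 := hc j hwj
  obtain ⟨i, hci⟩ : ∃ i, c i ≠ 0 := Function.ne_iff.mp hc0
  have hij : i ≠ j := fun h => hci (h ▸ hcj)
  set δ' := δ.transform (fun l => (X l : MvPowerSeries (Fin (2 + 1)) k)) w c i with hδ'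
  have hadm' : Admissible (X 0 * TupleGame.slice i G) δ' := admissible_transform hadm hperm hc hfac hG hci
  have hhead' : δ'.head ≤ δ.head := Decoration.head_transform_le hperm hc hf hci
  refine ⟨i, hci, Or.inl ⟨hadm', ?_⟩⟩
  change δ'.head < δ.head ∨ (δ'.head = δ.head ∧ (δ'.HCol ∨ δ'.GoodDir))
  by_cases hlt : δ'.head < δ.head
  · exact Or.inl hlt
  have heq : δ'.head = δ.head := le_antisymm hhead' (not_lt.mp hlt)
  have hO' : δ'.O = ∅ := Decoration.transform_O_eq_empty_of_head_eq hO heq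
  have ho' : δ'.o = δ.o := Decoration.o_transform_of_head_eq heq
  have hc' : δ'.c = δ.c := Decoration.c_transform_of_head_eq heq
  refine Or.inr ⟨heq, ?_⟩
  by_cases hH : δ'.HCol
  · exact Or.inl hH
  obtain ⟨ℓ', hℓ'⟩ := Decoration.exists_isDirForm_of_not_hCol₁ hadm' (by rw [ho']; exact ho) hH
  -- the chart transform of `f` and the new equation
  set Gf := satPart (δ.fChart (fun l => (X l : MvPowerSeries (Fin (2 + 1)) k)) w c) with hGf
  have hfacf : subst (CobordantChart.chart w c) δ.f = X 0 ^ δ.o * Gf := by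
    obtain ⟨hfacw, -⟩ := Decoration.fChart_eq (δ := δ) (c := c) hmv hc hf
    rw [subst_X_fun, Decoration.satExp_fChart_eq_o hperm hc hf] at hfacw
    exact hfacw
  have hf' : δ'.f = TupleGame.slice i Gf := by
    rw [hδ', Decoration.transform_f_eq_strict_of_o_transform_eq hperm hc hf hci ho']
    unfold Decoration.strict
    rfl
  -- near: the answer is an invariance vector, hence in the directrix plane
  have hnear : ((δ.o : ℕ) : ℕ∞) ≤ (TupleGame.slice i Gf).order := by
    have h := Decoration.order_totalO hadm'
    rw [hO', Finset.prod_empty, mul_one, hf', hc', hc_eq] at h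
    exact h.ge
  have hinv : δ.IsInv c := by
    intro v
    rw [hg, hc_eq]
    have h := TOT2Near.initEval_add_smul_eq_of_near_curve w c hw1 hc i hci δ.f hpermw hfacf hnear 1 v
    rwa [one_smul] at h
  have hdot : dotProduct ℓ c = 0 := hℓ.dotProduct_eq_zero_of_isInv (by rw [hc_eq]; omega) hinv
  -- both support letters leave: some `l ≠ i` with `ℓ_l ≠ 0 ≠ c_l`
  obtain ⟨l, hli, hℓl, hcl⟩ : ∃ l, l ≠ i ∧ ℓ l ≠ 0 ∧ c l ≠ 0 := by
    by_contra hnone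
    push Not at hnone
    rw [dotProduct_eq_single_term hnone] at hdot
    exact (mul_ne_zero (hne i hij) hci) hdot
  have hlj : l ≠ j := fun h => hℓl (h ▸ hj0)
  obtain ⟨p, rfl⟩ := Fin.exists_succAbove_eq hli
  -- the new coordinate `y_{p⁺}` is not a boundary letter, and `ℓ′_{p⁺} ≠ 0`
  have hnot : p.succ ∉ δ'.E := fun h => hcl ((Decoration.succ_mem_transform_E_iff δ w hci p).mp h).2
  have hcoeff : coeff (Finsupp.single p.succ δ.o) (TupleGame.slice i Gf) = coeff (Finsupp.single (i.succAbove p) δ.o) δ.f :=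
    coeff_single_slice_chart w c hw1 hc i δ.f hpermw hfacf p (hwl _ hlj)
  have hℓ'p : ℓ' p.succ ≠ 0 := by
    intro h0
    have hcδ' : δ'.c ≠ 0 := by rw [hc', hc_eq]; omega
    have h1 := (hℓ'.apply_eq_zero_iff_coeff hcδ' p.succ).mp h0
    rw [hO', Finset.prod_empty, mul_one, hf', hc', hc_eq, hcoeff] at h1
    have h2 : ℓ (i.succAbove p) = 0 := by
      rw [hℓ.apply_eq_zero_iff_coeff (by rw [hc_eq]; omega), hg, hc_eq]
      exact h1
    exact hℓl h2
  exact Or.inr ⟨hO', ℓ', hℓ', p.succ, hnot, hℓ'p⟩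

/-- **REGIME (B) «LETTERS IN BAD POSITION» EXITS** (three letters, `k` infinite): from an admissibly decorated state with `o ≥ 2` in bad position
the director wins to «admissibly decorated, and: head drop, or same head with apex column or good position». -/
theorem dbWinsTo_exit_of_badDir₁ [Infinite k] {b : MvPowerSeries (Fin (2 + 1)) k} {δ : Decoration k 2} (hadm : Admissible b δ)
    (ho : 1 ≤ δ.o) (hbad : δ.BadDir) :
    DBWinsTo (fun τ : MvPowerSeries (Fin (2 + 1)) k × Decoration k 2 =>
      Admissible τ.1 τ.2 ∧ (τ.2.head < δ.head ∨ (τ.2.head = δ.head ∧ (τ.2.HCol ∨ τ.2.GoodDir)))) (b, δ) := by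
  classical
  obtain ⟨hO, ℓ, hℓ, hsupp, j₁, j₂, hj, hj₁, hj₂⟩ := hbad
  by_cases hfull : ∀ j, ℓ j ≠ 0
  · exact dbWinsTo_exit_of_badDir_level₁ hadm ho hO hℓ hsupp (Or.inl hfull)
  push Not at hfull
  obtain ⟨j, hj0⟩ := hfull
  have hne : ∀ l, l ≠ j → ℓ l ≠ 0 := forall_ne_of_two_ne_zero hj hj₁ hj₂ hj0
  by_cases hin : InOffIdeal j δ.o δ.f
  · exact dbWinsTo_exit_of_badDir_inOffIdeal₁ hadm ho hO hℓ hj0 hne hin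
  · obtain ⟨r, hr⟩ := exists_not_level_of_not_inOffIdeal hin
    exact dbWinsTo_exit_of_badDir_level₁ hadm ho hO hℓ hsupp (Or.inr ⟨j, hj0, hne, r, hr⟩)

end NCResBad

/-- **REGIME (B) IN B-PERMISSIBLE FORM FROM `o ≥ 1`** (three letters, `k` algebraically closed — infinite suffices). -/
theorem regimeBadB₁ [IsAlgClosed k] :
    ∀ (b : MvPowerSeries (Fin (2 + 1)) k) (δ : Decoration k 2), Admissible b δ → 1 ≤ δ.o → ¬ δ.HCol → δ.BadDir →
      DBWinsTo (fun τ => Admissible τ.1 τ.2 ∧ (τ.2.head < δ.head ∨ (τ.2.head = δ.head ∧ (τ.2.HCol ∨ τ.2.GoodDir)))) (b, δ) := by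
  haveI : Infinite k := IsAlgClosed.instInfinite
  exact fun b δ hadm ho _ hbad => NCResBad.dbWinsTo_exit_of_badDir₁ hadm ho hbad

end TameFourTupleDrop

end Summit.ResolutionOfSingularities.ResolutionOfSingularities.Theorems

end
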